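import Literature.MathematicalPhysics.QuantumFieldTheory.Balaban1983to89.B15Prop1LocalLettersRecord
import Literature.MathematicalPhysics.QuantumFieldTheory.Balaban1983to89.B15Eq177ValueInvariance

/-!
# `Balaban1983to89.B15Prop1LocalLettersOfFun` — [Balaban1989LargeFieldI] Prop. 1 p. 194 / [Balaban1989LargeFieldII] pp. 357–359: THE N12∕s1
# LOCAL ENDPOINT OVER A BARE FUNCTION FAMILY `f i : GaugeField P (k i) SU2 → ℝ` WITH THE VALUE-INVARIANCE LETTER — the (181) configuration-level
# covariance `Cov181` and the background datum `bg`∕`av`∕`hk` of `B15Prop1LocalLettersRecord.exists_domain_prop1Printed_lfVarOn_std_su2_box_regular`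
# REPLACED by p. 194's sentence *«The function is invariant with respect to the group of all gauge transformations defined on Λ»* as a
# hypothesis `hf` on `f`; and its instance at NODE 00's solution map of record with `hf` DISCHARGED (`B15Eq177ValueInvariance`)

statement-level skeleton of published theorems with citation tags; proofs where landed; nothing here is a claim about
the Yang–Mills mass gap

Cell pub-ymgap, HUMAN RULING D-0062 (Track A full width), seat `pub-ymgap-dag-n12-c` (R134 acceleration seat (a), strategy s1 of DAG node N12 = [B15];
generation g6, second product; LOCATED-181, pub-ymgap INBOX 2026-08-27 ≈10:06Z — see the header of `B15Eq177ValueInvariance`).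

WHY.  Every endpoint of the N12∕s1 chain since g3 is stated at print's instance `InstOn.std bg M₁ Z Λ k M a₁ An` of the carrier of record and carries
`h181 : ∀ u, Cov181 bg (Bj M₁ Z k) (blockLift k u)`; that letter is NOT satisfiable at NODE 00's totalised solution maps
(`B15Eq177ValueInvariance.not_cov181_bgOfRecord`), while the chain uses it only through the VALUE invariance of (1.77).  Print's instance depends
on the background only through the function (1.77) (`InstOn.std_eq_mk`, `rfl`), so the honest interface is a statement about a BARE function
family `f i` with the value-invariance letter `hf : f i (V^u) = f i V`.  This file states and proves it — ONE theorem assembling the local chain's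
layers 5–10 (`B15Prop1LocalLettersRecord.prop1Printed_lfVarOn_su2_box_G0_of_167_local` + Proposition 4 [15] → Lipschitz
(`B15Prop1LipschitzFromProp4`) + `H* := H†` (`B15Prop1AdjointOfRecord.norm_adjoint_apply_le`) + the domain constant
(`B15Prop1CarrierOnSU2BoxExt193.thresholds_exist`) + (c3) from differentiability in print's coordinates
(`B15Prop1ChartRecentering.exists_hasFDerivAt_of_differentiableAt`, `B15Prop1CriticalViaSlice.isCriticalPt_iff_of_hasDerivAt`)), all BY NAME —
and instantiates it at `f i := fun177std (Node00.bgOfRecord av reg) M₁ (Z i) (k i)` with `hf` PROVED (`B15Eq177ValueInvariance.fun177std_bgOfRecord_gaugeAct`).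

WHAT THIS FILE PROVES (no `sorry`, no definition, no `… : Prop` fact; axioms standard).
* §1 `InstOn.std_eq_mk` — print's instance IS the instance of the bare function `fun177std bg M₁ Z k` (`rfl`).
* §2 ★★ `exists_domain_prop1Printed_lfVarOn_ofFun_regular` — for ANY function family `f i` invariant under the gauge transformations of `T^{(k i)}`:
  `∃ a₁ > 0, B15.Prop1Printed (lfVarOn su2Chart fun i => ⟨⟨k i, Z i, Λ i, M i, f i, An i⟩, domReg (Z i) (k i) (a₁ i)⟩)` from the letters of the local
  endpoint (`hlead`, `hH`, `hW`∕`hWdV`, `hA`, `hJ`, `hG`, `hAn`, structural) stated for `f i` — `SU(2)`, parallelepipeds, `d ≥ 3`, x₁-axial `G₀`, the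
  p. 193 extension pinned.
* §3 ★★ `exists_domain_prop1Printed_lfVarOn_std_su2_box_regular_ofRecord` — the same AT NODE 00's solution map of record `bgOfRecord av reg` (any
  gauge-invariant class `reg`, `k i ≤ m + K`): the conclusion of `B15Prop1LocalLettersRecord.exists_domain_prop1Printed_lfVarOn_std_su2_box_regular`
  verbatim at `bg := bgOfRecord av reg`, WITHOUT the (181) letter.

HONEST SCOPE.  Count-neutral; a re-threading, nothing retracted (the landed `bg`-theorems are the instances `f := fun177std bg …`, `hf ⇐ Cov181`);
the per-`V_k` analytic letters are untouched and remain NODE 00's; NOT a discharge of N12; nothing continuum ∕ OS ∕ mass-gap ∕ Clay.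
-/

noncomputable section

open Set Finset
open scoped BigOperators Matrix RealInnerProductSpace Real

namespace Literature.MathematicalPhysics.QuantumFieldTheory.Balaban1983to89.B15Prop1LocalLettersOfFun

open B15DeterminingSets GaugeField B16Sect1Backgrounds B15Prop1Carrier B8Eq17ClassAkV1
open B15Prop1CarrierOnSU2BoxExt193 (thresholds_exist)
open B15Prop1LipschitzFromProp4 (dV_zero_real_of_prop4Hyp lipschitz_real_of_prop4Hyp)
open B15Prop1AdjointOfRecord (norm_adjoint_apply_le)
open B15Prop1CriticalViaSlice (isCriticalPt_iff_of_hasDerivAt)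
open B15Prop1CriticalAtBoxG0 (treeOrder_G0 tgt_G0_mem)
open B15Prop1ChartRecentering (exists_hasFDerivAt_of_differentiableAt)
open B15Prop1LocalLettersRecord (prop1Printed_lfVarOn_su2_box_G0_of_167_local)
open B15Prop1ChartCalculusSU2 (E3)
open T4CubeChartGnomonic (SU2)
open B15Prop1ChartSU2 (su2Chart)
open B15Prop1SliceCoordinates (GaugeSlice ιA freeBonds norm_ιA_apply_le)
open T4AxialGaugeSmallField (castSite boxPlaqs)
open T4AxialGaugeFixing (TreeOrder boxDepth)
open B7Prop1Explicit (e e_apply)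
open B6BondElimination (unitVec)
open B16Eq18Proof (box mem_box)
open B15Extension193 (extend)
open B15ShellGauge193 (shellGauge)
open B5Bounds167Lattice (formDk ofRealCfg)
open B14.Eq213DetSet B14.Eq216Concrete B15Sect1Instances B15Eq177GaugeInvariance B15Eq177ValueInvariance
open Literature.MathematicalPhysics.QuantumFieldTheory.BalabanImbrieJaffe1984to88.BIJ85Eq453GaugeField
open B11Prop6Scheme (Prop4Hyp)

variable {P : Params}

/-! ## §1 Print's instance depends on the background only through the function (1.77) -/

/-- `InstOn.std bg M₁ Z Λ k M a₁ An` IS the instance built from the bare function `fun177std bg M₁ Z k` (`rfl`): every statement of the N12∕s1 chain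
about `lfVarOn su2Chart (fun i => InstOn.std bg …)` is a statement about that function alone. [cite: Balaban1989LargeFieldI, (1.77) p.194] -/
theorem InstOn.std_eq_mk {G : Type} [GaugeGroup G] {av : ∀ j, Averaging P j G} (bg : DetBackground P G av) (M₁ : ℕ)
    (Z Λ : Set (Site P 0)) (k : ℕ) (M a₁ : ℝ) (An : ℝ → GaugeField P k G → Prop) :
    InstOn.std bg M₁ Z Λ k M a₁ An = ⟨⟨k, Z, Λ, M, fun177std bg M₁ Z k, An⟩, domReg Z k a₁⟩ := rfl

/-! ## §2 The local endpoint over a bare function family with the value-invariance letter -/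

section OfFun

open Classical

/-- ★★ **THE LOCAL ENDPOINT OF PROPOSITION 1 [IV] OVER A BARE FUNCTION FAMILY** — `B15Prop1LocalLettersRecord.exists_domain_prop1Printed_lfVarOn_std_su2_box_regular`
with print's function `A ∘ U_{k,Z}` replaced by an arbitrary `f i : GaugeField P (k i) SU2 → ℝ` and the (181) letter `Cov181` replaced by p. 194's
sentence *«The function is invariant with respect to the group of all gauge transformations defined on Λ»* as the hypothesis `hf`.  From the letters
`hlead` ((1.7) for the leading form, abstract `H`, `Δ₁`), `hH` ((190)), `hW`∕`hWdV` (Proposition 4 [15]), `hA` ((1.11)–(1.12), first variation),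
`hJ` (p. 359, the current), `hG` (differentiability in print's coordinates), `hAn` (the carried clause), all at `eR`-regular boundary data and on the
ball `‖B′‖ ≤ r ≤ 1/2`, plus the structural box∕margin∕constant hypotheses: `∃ a₁ > 0, B15.Prop1Printed (lfVarOn su2Chart fun i => ⟨⟨k i, Z i, Λ i, M i,
f i, An i⟩, domReg (Z i) (k i) (a₁ i)⟩)`.  Layers 5–10 of the local chain BY NAME. [cite: Balaban1989LargeFieldI, Prop. 1 (1.77)–(1.78) p.194, p.193;
Balaban1989LargeFieldII, pp.357–359, (1.12); Balaban1985Variational, Prop. 4 pp.292–293, (190) p.308] -/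
theorem exists_domain_prop1Printed_lfVarOn_ofFun_regular (hd3 : 3 ≤ P.d) (h0 : 0 < P.d) {ι : Type}
    (Z Λ : ι → Set (Site P 0)) (k : ι → ℕ) (M : ι → ℝ)
    (f : ∀ i, GaugeField P (k i) SU2 → ℝ) (An : ∀ i, ℝ → GaugeField P (k i) SU2 → Prop)
    -- p. 194 «The function is invariant with respect to the group of all gauge transformations defined on Λ» (asked for all of `T^{(k)}`'s)
    (hf : ∀ i (u : GaugeTransf P (k i) SU2) (V : GaugeField P (k i) SU2), f i (gaugeAct u V) = f i V)
    (eR : ι → ℝ) (heR : ∀ i, 0 < eR i)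
    (T : ∀ i, Finset (PBond P (k i)))
    {F : ι → Type*} [∀ i, NormedAddCommGroup (F i)] [∀ i, InnerProductSpace ℝ (F i)] [∀ i, FiniteDimensional ℝ (F i)]
    (H : ∀ i, GaugeField P (k i) SU2 →
      (GaugeSlice (pts (k i) (Λ i)) (T i) (EuclideanSpace ℝ (Fin 3)) →ₗ[ℝ] F i))
    (Δ₁ : ∀ i, GaugeField P (k i) SU2 → (F i →ₗ[ℝ] F i)) (dV : ∀ i, GaugeField P (k i) SU2 → F i → F i)
    {Fc : ι → Type*} [∀ i, NormedAddCommGroup (Fc i)] [∀ i, NormedSpace ℂ (Fc i)] (emb : ∀ i, F i → Fc i)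
    (hemb : ∀ i (u v : F i), ‖emb i u - emb i v‖ = ‖u - v‖) (hemb0 : ∀ i, emb i 0 = 0)
    (W : ∀ i, GaugeField P (k i) SU2 → Fc i → Fc i) {C₄ a₃ a : ι → ℝ} (hC₄ : ∀ i, 0 ≤ C₄ i) (ha : ∀ i, 0 < a i)
    (hW : ∀ i Vk, PlaqSmallOn (plaqsInside (pts (k i) (Z i ∩ (Λ i)ᶜ))) (eR i) Vk → Prop4Hyp (W i Vk) (C₄ i) (a₃ i))
    (hWdV : ∀ i Vk (u : F i), W i Vk (emb i u) = emb i (dV i Vk u))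
    (J : ∀ i, GaugeField P (k i) SU2 → F i)
    (lo hi : ι → Fin P.d → ℤ) (n : ι → ℕ) (hn : ∀ i κ, hi i κ ≤ lo i κ + n i) (hN : ∀ i, n i + 2 < P.sitesPerDir (k i))
    (hbox : ∀ i, pts (k i) (Λ i) = (castSite '' Set.Icc (lo i) (hi i) : Set (Site P (k i))))
    (hZ : ∀ i, (boxPlaqs (lo i - 1) (hi i + 1) : Set (Plaq P (k i))) ⊆ plaqsInside (pts (k i) (Z i)))
    -- (`G₀`: the image is taken with the classical `DecidableEq` instance, as in p518722's statement — any other instance gives the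
    -- same `Finset`, the instances forming a subsingleton)
    (hTG0 : ∀ i, T i = @Finset.image (Fin P.d → ℤ) (PBond P (k i)) (fun a b => Classical.propDecidable (a = b))
      (fun x => (⟨castSite (x - unitVec ⟨0, h0⟩), ⟨0, h0⟩⟩ : PBond P (k i))) (box (fun κ => (hi i κ - lo i κ + 1).toNat) (lo i)))
    (hN5 : ∀ i κ, ((hi i κ - lo i κ + 1).toNat : ℤ) + 5 < P.sitesPerDir (k i))
    (K : ι → ℕ) (hK1 : ∀ i, 1 ≤ K i) (hKn : ∀ i κ, (hi i κ - lo i κ + 1).toNat ≤ K i)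
    (ext : ∀ i, GaugeField P (k i) SU2 → GaugeField P (k i) SU2)
    (hext : ∀ i Vk, ext i Vk = extend (pts (k i) (Λ i)) (shellGauge Vk (lo i) (hi i)) Vk)
    (hlohi : ∀ i, lo i ≤ hi i)
    {γ h₁ cJ bx : ℝ} (hγ : 0 < γ) (hh₁ : 0 ≤ h₁) (hcJ : 0 ≤ cJ) (hbx : 0 ≤ bx)
    (hbxM : ∀ i, 12 * (P.d : ℝ) * ((n i : ℝ) + 2) ^ 2 ≤ bx * (M i) ^ 2)
    {ρ r eA Cerr : ι → ℝ} (hr : ∀ i, 0 < r i) (heA : ∀ i, 0 < eA i) (hM : ∀ i, 1 ≤ (M i))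
    (n' : ι → ℕ) (hn' : ∀ i, 1 ≤ n' i)
    (hlead : ∀ i Vk, PlaqSmallOn (plaqsInside (pts (k i) (Z i ∩ (Λ i)ᶜ))) (eR i) Vk →
      ∀ X : GaugeSlice (pts (k i) (Λ i)) (T i) (EuclideanSpace ℝ (Fin 3)),
      |⟪H i Vk X, Δ₁ i Vk (H i Vk X)⟫ -
          ∑ a : Fin 3, formDk (n' i) (fun _ : Fin P.d => P.sitesPerDir (k i))
            (ofRealCfg (fun _ : Fin P.d => P.sitesPerDir (k i)) fun j =>
              ιA (pts (k i) (Λ i)) (T i) X ⟨j.1, j.2⟩ a)| ≤ Cerr i * ‖X‖ ^ 2)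
    (hsm : ∀ i, Cerr i ≤ (4 / Real.pi ^ 2) ^ (P.d + 2) / (2 * (3 * (K i : ℝ) ^ 2 + 2 * (K i : ℝ) ^ 4)))
    (hγle : ∀ i, γ / (M i) ^ 5 ≤ (4 / Real.pi ^ 2) ^ (P.d + 2) / (2 * (3 * (K i : ℝ) ^ 2 + 2 * (K i : ℝ) ^ 4)))
    (hH : ∀ i Vk, PlaqSmallOn (plaqsInside (pts (k i) (Z i ∩ (Λ i)ᶜ))) (eR i) Vk → ∀ x, ‖H i Vk x‖ ≤ h₁ * ‖x‖)
    (hρ : ∀ i, h₁ * r i ≤ ρ i) (ha₃ : ∀ i, 2 * (ρ i + a i) ≤ a₃ i)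
    (hsmall : ∀ i, (M i) ^ 5 / γ * h₁ * (4 * C₄ i * (ρ i + a i)) * h₁ ≤ 1 / 2)
    (hA : ∀ i Vk, PlaqSmallOn (plaqsInside (pts (k i) (Z i ∩ (Λ i)ᶜ))) (eR i) Vk →
      ∀ X δ : GaugeSlice (pts (k i) (Λ i)) (T i) (EuclideanSpace ℝ (Fin 3)), ‖X‖ ≤ r i →
      HasDerivAt (fun s : ℝ => f i (expMul su2Chart (ιA (pts (k i) (Λ i)) (T i) (X + s • δ)) (ext i Vk)))
      (⟪H i Vk δ, J i Vk⟫ + ⟪H i Vk δ, Δ₁ i Vk (H i Vk X)⟫ + ⟪H i Vk δ, dV i Vk (H i Vk X)⟫) 0)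
    (hJ : ∀ i ε Vk, 0 < ε → PlaqSmallOn (plaqsInside (pts (k i) (Z i ∩ (Λ i)ᶜ))) ε Vk → ‖J i Vk‖ ≤ cJ * ε)
    (hG : ∀ i Vk, PlaqSmallOn (plaqsInside (pts (k i) (Z i ∩ (Λ i)ᶜ))) (eR i) Vk →
      ∀ B : GaugeSlice (pts (k i) (Λ i)) (T i) (EuclideanSpace ℝ (Fin 3)), ‖B‖ ≤ r i →
      DifferentiableAt ℝ (fun B' : VecField P (k i) (EuclideanSpace ℝ (Fin 3)) => f i (expMul su2Chart B' (ext i Vk)))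
        (ιA (pts (k i) (Λ i)) (T i) B))
    (hr2 : ∀ i, r i ≤ 1 / 2)
    (hAn : ∀ i ε Vk, 0 < ε → ε ≤ eA i → PlaqSmallOn (plaqsInside (pts (k i) (Z i ∩ (Λ i)ᶜ))) ε Vk → An i ε Vk)
    : ∃ a₁ : ι → ℝ, (∀ i, 0 < a₁ i) ∧
      B15.Prop1Printed (lfVarOn su2Chart fun i =>
        (⟨⟨k i, Z i, Λ i, M i, f i, An i⟩, domReg (Z i) (k i) (a₁ i)⟩ : InstOn P SU2)) := by
  -- the classical `DecidableEq` instance on bonds, as in the statement (`hTG0`, the slices); local instances take precedence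
  letI : ∀ i, DecidableEq (PBond P (k i)) := fun i a b => Classical.propDecidable (a = b)
  -- print's regularity predicate at the scale `eR` and its bridge (monotonicity of `<`)
  set Rg : ∀ i, GaugeField P (k i) SU2 → Prop :=
    fun i Vk => PlaqSmallOn (plaqsInside (pts (k i) (Z i ∩ (Λ i)ᶜ))) (eR i) Vk with hRg_def
  have hRg : ∀ i ε Vk, 0 < ε → ε ≤ eR i → PlaqSmallOn (plaqsInside (pts (k i) (Z i ∩ (Λ i)ᶜ))) ε Vk → Rg i Vk :=
    fun _ _ _ _ hle hV p hp => (hV p hp).trans_le hle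
  -- the domain constant `a₁` and the thresholds, chosen (p. 194 «e.g., |∂V_k − 1| < a₁ on Z», p. 359 «for ε sufficiently small»)
  have hex : ∀ i, ∃ δc a₁ eD : ℝ, 0 < δc ∧ 0 < a₁ ∧ 0 < eD ∧
      Real.sqrt (freeBonds (pts (k i) (Λ i)) (T i)).card * (π / 2 * δc) ≤ r i ∧
      (∀ ε : ℝ, 0 < ε → ε ≤ eD → ((n i : ℝ) + 2) * ((n i : ℝ) + P.d) * (a₁ + (bx * (M i) ^ 2 * ε + ε)) < δc) ∧
      ∀ ε : ℝ, 0 < ε → ε ≤ eD → (4 * 1 * (2 * (M i) ^ 5 * h₁ * cJ / γ) + bx * (M i) ^ 2) * ε < a₁ :=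
    fun i => thresholds_exist _ (hr i) hγ (hM i) hh₁ hcJ hbx (n i) P.d
  choose δc a₁ eD hδc ha₁ heD hN' hδ he1 using hex
  have hρ0 : ∀ i, 0 ≤ ρ i := fun i => (mul_nonneg hh₁ (hr i).le).trans (hρ i)
  refine ⟨a₁, ha₁, ?_⟩
  -- layers 5–10 by name: (1.67) + print's box instance + Prop. 4 → Lipschitz + `H* := H†` + (c3) from `hG`
  refine prop1Printed_lfVarOn_su2_box_G0_of_167_local hd3 h0
    (fun i => (⟨⟨k i, Z i, Λ i, M i, f i, An i⟩, domReg (Z i) (k i) (a₁ i)⟩ : InstOn P SU2)) Rg T H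
    (fun i Vk => LinearMap.adjoint (H i Vk)) (fun i Vk x y => (LinearMap.adjoint_inner_right (H i Vk) x y).symm) Δ₁ dV J
    lo hi n hn hN hbox hZ hTG0 hN5 K hK1 hKn ext hext hlohi hγ hh₁ hh₁ hcJ hbx hbxM
    (ℓ := fun i => 4 * C₄ i * (ρ i + a i)) (fun i => by have := hC₄ i; have := ha i; have := hρ0 i; positivity)
    hr heA heD heR hRg hδc (fun i => (ha₁ i).le) hM n' hn' hlead hsm hγle hH
    (fun i Vk hR z => norm_adjoint_apply_le (H i Vk) hh₁ (hH i Vk hR) z)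
    (fun i Vk hR => dV_zero_real_of_prop4Hyp (emb i) (hemb i) (hemb0 i) (hW i Vk hR) (by linarith [ha₃ i, ha i, hρ0 i]) (hWdV i Vk))
    (fun i Vk hR => lipschitz_real_of_prop4Hyp (emb i) (hemb i) (hemb0 i) (hW i Vk hR) (hC₄ i) (ha i) (hρ0 i) (ha₃ i) (hWdV i Vk))
    hρ hsmall (fun i Vk hR X δ hX => ?_) hJ (fun i Vk hR B hB => ?_) (fun i u V _ => hf i u V) hAn (fun i => rfl) hN' hδ he1
  · -- (m5): the first-variation letter in the `H†` form
    simpa only [LinearMap.adjoint_inner_right] using hA i Vk hR X δ hX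
  · -- (c3): criticality at the chart point `exp(i·ιA B)·Ṽ_k` ⇔ (1.12), from `hG` through the slice criterion over the x₁-axial `G₀`
    have hNw : ∀ κ, hi i κ - lo i κ + 1 < (P.sitesPerDir (k i) : ℤ) := fun κ => by
      have h5 := hN5 i κ
      have : hi i κ - lo i κ + 1 ≤ ((hi i κ - lo i κ + 1).toNat : ℤ) := Int.self_le_toNat _
      linarith
    have hT : TreeOrder (T i) PBond.tgt (boxDepth (lo i - e ⟨0, h0⟩) (hi i)) := by
      rw [hTG0 i]; exact treeOrder_G0 h0 hNw
    have hv : ∀ b ∈ T i, b.tgt ∈ pts (k i) (Λ i) := fun b hb => by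
      rw [hbox i]; rw [hTG0 i] at hb; exact tgt_G0_mem h0 (lo i) (hi i) b hb
    have hX : ∀ b, ‖ιA (pts (k i) (Λ i)) (T i) B b‖ < π := fun b =>
      (norm_ιA_apply_le B b).trans_lt (hB.trans_lt ((hr2 i).trans_lt (by linarith [Real.pi_gt_three])))
    obtain ⟨D, hD⟩ := exists_hasFDerivAt_of_differentiableAt _ (ext i Vk) hX (hG i Vk hR B hB)
    have key := isCriticalPt_iff_of_hasDerivAt hT hv (fun u hu V => hf i u V) (ext i Vk) (hB.trans (hr2 i)) hD
      (fun δ => hA i Vk hR B δ hB)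
    simpa only [LinearMap.adjoint_inner_right] using key

end OfFun

/-! ## §3 At NODE 00's solution map of record: the local endpoint WITHOUT the (181) letter -/

section Record

open Classical

/-- ★★ **THE LOCAL ENDPOINT AT NODE 00'S SOLUTION MAP OF RECORD, (181)-FREE** — the conclusion of
`B15Prop1LocalLettersRecord.exists_domain_prop1Printed_lfVarOn_std_su2_box_regular` VERBATIM at `bg := bgOfRecord av reg` (the totalised (2.12) solution
map of `Node00.SmallFieldChiOfRecord`, any gauge-invariant class `reg`, `k i ≤ m + K`), with the letter `h181` GONE: p. 194's invariance of (1.77) is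
the theorem `B15Eq177ValueInvariance.fun177std_bgOfRecord_gaugeAct`. [cite: Balaban1989LargeFieldI, Prop. 1 (1.77)–(1.78) p.194, p.193;
Balaban1989LargeFieldII, pp.357–359, (1.12); Balaban1985Variational, Prop. 4 pp.292–293, (190) p.308] -/
theorem exists_domain_prop1Printed_lfVarOn_std_su2_box_regular_ofRecord (hd3 : 3 ≤ P.d) (h0 : 0 < P.d) {ι : Type}
    (av : ∀ j, Averaging P j SU2) {reg : Set (GaugeField P 0 SU2)}
    (hreg : ∀ (w : GaugeTransf P 0 SU2) (U : GaugeField P 0 SU2), U ∈ reg → gaugeAct w U ∈ reg)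
    (M₁ : ℕ) (Z Λ : ι → Set (Site P 0)) (k : ι → ℕ) (M : ι → ℝ)
    (An : ∀ i, ℝ → GaugeField P (k i) SU2 → Prop) (hk : ∀ i, k i ≤ P.m + P.K)
    (eR : ι → ℝ) (heR : ∀ i, 0 < eR i)
    (T : ∀ i, Finset (PBond P (k i)))
    {F : ι → Type*} [∀ i, NormedAddCommGroup (F i)] [∀ i, InnerProductSpace ℝ (F i)] [∀ i, FiniteDimensional ℝ (F i)]
    (H : ∀ i, GaugeField P (k i) SU2 →
      (GaugeSlice (pts (k i) (Λ i)) (T i) (EuclideanSpace ℝ (Fin 3)) →ₗ[ℝ] F i))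
    (Δ₁ : ∀ i, GaugeField P (k i) SU2 → (F i →ₗ[ℝ] F i)) (dV : ∀ i, GaugeField P (k i) SU2 → F i → F i)
    {Fc : ι → Type*} [∀ i, NormedAddCommGroup (Fc i)] [∀ i, NormedSpace ℂ (Fc i)] (emb : ∀ i, F i → Fc i)
    (hemb : ∀ i (u v : F i), ‖emb i u - emb i v‖ = ‖u - v‖) (hemb0 : ∀ i, emb i 0 = 0)
    (W : ∀ i, GaugeField P (k i) SU2 → Fc i → Fc i) {C₄ a₃ a : ι → ℝ} (hC₄ : ∀ i, 0 ≤ C₄ i) (ha : ∀ i, 0 < a i)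
    (hW : ∀ i Vk, PlaqSmallOn (plaqsInside (pts (k i) (Z i ∩ (Λ i)ᶜ))) (eR i) Vk → Prop4Hyp (W i Vk) (C₄ i) (a₃ i))
    (hWdV : ∀ i Vk (u : F i), W i Vk (emb i u) = emb i (dV i Vk u))
    (J : ∀ i, GaugeField P (k i) SU2 → F i)
    (lo hi : ι → Fin P.d → ℤ) (n : ι → ℕ) (hn : ∀ i κ, hi i κ ≤ lo i κ + n i) (hN : ∀ i, n i + 2 < P.sitesPerDir (k i))
    (hbox : ∀ i, pts (k i) (Λ i) = (castSite '' Set.Icc (lo i) (hi i) : Set (Site P (k i))))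
    (hZ : ∀ i, (boxPlaqs (lo i - 1) (hi i + 1) : Set (Plaq P (k i))) ⊆ plaqsInside (pts (k i) (Z i)))
    -- (`G₀`: the image is taken with the classical `DecidableEq` instance, as in p518722's statement — any other instance gives the
    -- same `Finset`, the instances forming a subsingleton)
    (hTG0 : ∀ i, T i = @Finset.image (Fin P.d → ℤ) (PBond P (k i)) (fun a b => Classical.propDecidable (a = b))
      (fun x => (⟨castSite (x - unitVec ⟨0, h0⟩), ⟨0, h0⟩⟩ : PBond P (k i))) (box (fun κ => (hi i κ - lo i κ + 1).toNat) (lo i)))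
    (hN5 : ∀ i κ, ((hi i κ - lo i κ + 1).toNat : ℤ) + 5 < P.sitesPerDir (k i))
    (K : ι → ℕ) (hK1 : ∀ i, 1 ≤ K i) (hKn : ∀ i κ, (hi i κ - lo i κ + 1).toNat ≤ K i)
    (ext : ∀ i, GaugeField P (k i) SU2 → GaugeField P (k i) SU2)
    (hext : ∀ i Vk, ext i Vk = extend (pts (k i) (Λ i)) (shellGauge Vk (lo i) (hi i)) Vk)
    (hlohi : ∀ i, lo i ≤ hi i)
    {γ h₁ cJ bx : ℝ} (hγ : 0 < γ) (hh₁ : 0 ≤ h₁) (hcJ : 0 ≤ cJ) (hbx : 0 ≤ bx)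
    (hbxM : ∀ i, 12 * (P.d : ℝ) * ((n i : ℝ) + 2) ^ 2 ≤ bx * (M i) ^ 2)
    {ρ r eA Cerr : ι → ℝ} (hr : ∀ i, 0 < r i) (heA : ∀ i, 0 < eA i) (hM : ∀ i, 1 ≤ (M i))
    (n' : ι → ℕ) (hn' : ∀ i, 1 ≤ n' i)
    (hlead : ∀ i Vk, PlaqSmallOn (plaqsInside (pts (k i) (Z i ∩ (Λ i)ᶜ))) (eR i) Vk →
      ∀ X : GaugeSlice (pts (k i) (Λ i)) (T i) (EuclideanSpace ℝ (Fin 3)),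
      |⟪H i Vk X, Δ₁ i Vk (H i Vk X)⟫ -
          ∑ a : Fin 3, formDk (n' i) (fun _ : Fin P.d => P.sitesPerDir (k i))
            (ofRealCfg (fun _ : Fin P.d => P.sitesPerDir (k i)) fun j =>
              ιA (pts (k i) (Λ i)) (T i) X ⟨j.1, j.2⟩ a)| ≤ Cerr i * ‖X‖ ^ 2)
    (hsm : ∀ i, Cerr i ≤ (4 / Real.pi ^ 2) ^ (P.d + 2) / (2 * (3 * (K i : ℝ) ^ 2 + 2 * (K i : ℝ) ^ 4)))
    (hγle : ∀ i, γ / (M i) ^ 5 ≤ (4 / Real.pi ^ 2) ^ (P.d + 2) / (2 * (3 * (K i : ℝ) ^ 2 + 2 * (K i : ℝ) ^ 4)))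
    (hH : ∀ i Vk, PlaqSmallOn (plaqsInside (pts (k i) (Z i ∩ (Λ i)ᶜ))) (eR i) Vk → ∀ x, ‖H i Vk x‖ ≤ h₁ * ‖x‖)
    (hρ : ∀ i, h₁ * r i ≤ ρ i) (ha₃ : ∀ i, 2 * (ρ i + a i) ≤ a₃ i)
    (hsmall : ∀ i, (M i) ^ 5 / γ * h₁ * (4 * C₄ i * (ρ i + a i)) * h₁ ≤ 1 / 2)
    (hA : ∀ i Vk, PlaqSmallOn (plaqsInside (pts (k i) (Z i ∩ (Λ i)ᶜ))) (eR i) Vk →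
      ∀ X δ : GaugeSlice (pts (k i) (Λ i)) (T i) (EuclideanSpace ℝ (Fin 3)), ‖X‖ ≤ r i →
      HasDerivAt (fun s : ℝ => (fun177std (Node00.bgOfRecord av reg) M₁ (Z i) (k i))
        (expMul su2Chart (ιA (pts (k i) (Λ i)) (T i) (X + s • δ)) (ext i Vk)))
      (⟪H i Vk δ, J i Vk⟫ + ⟪H i Vk δ, Δ₁ i Vk (H i Vk X)⟫ + ⟪H i Vk δ, dV i Vk (H i Vk X)⟫) 0)
    (hJ : ∀ i ε Vk, 0 < ε → PlaqSmallOn (plaqsInside (pts (k i) (Z i ∩ (Λ i)ᶜ))) ε Vk → ‖J i Vk‖ ≤ cJ * ε)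
    (hG : ∀ i Vk, PlaqSmallOn (plaqsInside (pts (k i) (Z i ∩ (Λ i)ᶜ))) (eR i) Vk →
      ∀ B : GaugeSlice (pts (k i) (Λ i)) (T i) (EuclideanSpace ℝ (Fin 3)), ‖B‖ ≤ r i →
      DifferentiableAt ℝ (fun B' : VecField P (k i) (EuclideanSpace ℝ (Fin 3)) =>
        (fun177std (Node00.bgOfRecord av reg) M₁ (Z i) (k i)) (expMul su2Chart B' (ext i Vk))) (ιA (pts (k i) (Λ i)) (T i) B))
    (hr2 : ∀ i, r i ≤ 1 / 2)
    (hAn : ∀ i ε Vk, 0 < ε → ε ≤ eA i → PlaqSmallOn (plaqsInside (pts (k i) (Z i ∩ (Λ i)ᶜ))) ε Vk → An i ε Vk)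
    : ∃ a₁ : ι → ℝ, (∀ i, 0 < a₁ i) ∧
      B15.Prop1Printed (lfVarOn su2Chart fun i =>
        InstOn.std (Node00.bgOfRecord av reg) M₁ (Z i) (Λ i) (k i) (M i) (a₁ i) (An i)) :=
  exists_domain_prop1Printed_lfVarOn_ofFun_regular hd3 h0 Z Λ k M (fun i => fun177std (Node00.bgOfRecord av reg) M₁ (Z i) (k i)) An
    (fun i u V => fun177std_bgOfRecord_gaugeAct av hreg M₁ (Z i) (hk i) u V) eR heR T H Δ₁ dV emb hemb hemb0 W hC₄ ha hW hWdV J lo hi n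
    hn hN hbox hZ hTG0 hN5 K hK1 hKn ext hext hlohi hγ hh₁ hcJ hbx hbxM hr heA hM n' hn' hlead hsm hγle hH hρ ha₃ hsmall hA hJ hG hr2 hAn

end Record

end Literature.MathematicalPhysics.QuantumFieldTheory.Balaban1983to89.B15Prop1LocalLettersOfFun

end
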